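import Mathlib
import Literature.NumberTheory.EllipticCurves.BurungaleCastellaGrossiSkinner2026.RefinedKolyvaginConjecture
import Literature.NumberTheory.EllipticCurves.HeegnerPointsKolyvaginTorsionProofs
import HarnessLib

/-!
# HeegnerPointsKolyvaginPrimitivity

Topic `Literature/NumberTheory/EllipticCurves`. Named literature fact(s) relocated by the gate from `Summits/BirchSwinnertonDyer/BirchSwinnertonDyer/Theorems/KolyvaginDepthDoorKNSupplyResidualPrimitivity.lean`
(accept-time relocation of `[cite]`d propositions written inline in a Summits proposal; human ruling 2026-08-15).
Sources: GrossLMS1991, WZhang2014, Zanarella2019.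

* `Literature.NumberTheory.EllipticCurves.Zanarella2019_kolyvaginClass_one_ne_zero_of_not_divisible`
-/

namespace Literature.NumberTheory.EllipticCurves

open scoped Classical
open Literature.NumberTheory.EllipticCurves Literature.NumberTheory.EllipticCurves.ModularForms WeierstrassCurve

/-- **Zanarella 2019 — the Heegner point Kolyvagin system is PRIMITIVE (its reduction mod `p` is
non-zero) as soon as one of its classes is not divisible by `p`** (M. C. Zanarella, arXiv:1908.09197 (2019), a THEOREM-level remark of the source's Kolyvagin-system
formalism, §2). Printed statements
(held text `paper:arxiv-1908.09197`, chunk locators): §1.1 (p0003 L76 – p0004 L63): *"Let `E/ℚ` be an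
elliptic curve and `K` be an imaginary quadratic field with discriminant `D_K < −4`. Let `N = N_E` … We
assume that `(N, D_K) = 1`. … (Heeg) `N⁻` is a square-free product of an even number of primes [here
`N⁻ = 1`: every `ℓ ∣ N` splits in `K`]. Let `p` be a prime number `p ∤ D_K` such that (good) `E` has good
reduction at `p`, (`p` big) `p ≥ 5`, … (res-surj) the residual representation of `T` is surjective. …
Denote by `κ` the usual Kolyvagin system of Heegner points for `H¹_BK(K, T)` … a collection of classes
`κ = {κ_n ∈ H¹_{BK(n)}(K, T/I_nT) : n square-free product of Kolyvagin primes}` that can be constructed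
under the above assumptions together with Assumption 1.1 [*"Either `N⁻ = 1` or …"*]. … We say that `κ` is
primitive if its reduction modulo `p`, denoted `κ̄ = {κ̄_n ∈ H¹_{BK(n)}(K, T/pT)}`, is nonzero."*;
Def. 2.17 (p0011 L20–L26, `R` a DVR, `p > 4`, `𝓛 ⊇ 𝓛_s`, `κ^{(k)}` the image of `κ` as a Kolyvagin
system for `(T/𝔪^k T, 𝓕, 𝓛^{(k)})`, `H^{(k)}(n) = H¹_{𝓕(n)}(K, T/𝔪^k T)`): *"`∂^{(∞)}(κ) := min{max{a :
κ_n^{(k)} ∈ 𝔪^a H^{(k)}(n)} : n ∈ 𝒩^{(k)}}`. We call `κ` primitive if `∂^{(∞)}(κ) = 0`."*; Prop. 2.18,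
proof (p0011 L35–L40): *"We note that `∂^{(∞)}(κ) = 0` is the same as `κ^{(1)} ≠ 0`."*; Rem. 2.20
(p0011 L48–L51): the triple `(T_pE, BK, 𝓛_1(T_pE))` of an elliptic `E/ℚ` is the case of §3.1
("finite level Kolyvagin systems", the classes from the Heegner points `P[m] ∈ E(K[m])`).
HENCE (the two sentences composed, nothing else): if for some square-free product `n ≠ 1` of Kolyvagin
primes the class `κ_n ∈ H¹(K, E[p^{M(n)}])` is not divisible by `p` — a fortiori not in
`𝔪 H^{(M(n))}(n) ⊆ p H¹(K, E[p^{M(n)}])`, so the term `(k, n) = (M(n), n)`, `n ∈ 𝒩^{(M(n))}`, of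
`∂^{(∞)}` vanishes — then `κ^{(1)} ≠ 0`: some `κ̄_{n'} = c_1(n') ∈ H¹(K, E[p])` is non-zero.
TRANSCRIPTION (tree vocabulary of `HeegnerPointsOfConductor` / the BCGS Thm. 2 record, whose classes and
divisibility currency are reused verbatim): `W/ℚ` globally minimal elliptic; `5 ≤ p`, good reduction at
`p`, ordinary (`p ∤ a_p`; idle for the finite-level system, carried from Assumption 1.3's supersingular
proviso so that nothing is stronger than print), `ρ̄_{E,p}` onto mod `p`; `K` imaginary quadratic,
`d_K < −4`, `p ∤ d_K`, `(d_K, N) = 1`, Heegner hypothesis for `N = W.conductorNorm ℤ`; a frame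
`(Dt, β, ι)` (the source's fixed parametrisation, orientation and embedding; `κ_n` for `n ≠ 1` ↦
`d.kolyvaginClass _ M(n)`, McCallum's cocycle of `P(n) = Σ σ D_n y(n)`, which differs from Howard's
normalisation by units of `ℤ/p^{M(n)}` — divisibility and vanishing mod `p` are unchanged); Kolyvagin
primes and `M(n)` as `Zhang2014.IsKolyvaginPrime` / `Zhang2014.levelIndex`. HYPOTHESIS: `¬ ∃ ξ ∈ H¹(K,
E[p^{M(n)}]), p • ξ = c_{M(n)}(n)` (non-divisibility in the FULL `H¹`, stronger than the source's
non-divisibility in `H¹_{BK(n)}`, so the fact is weaker than print). CONCLUSION: `∃ n' ∈ Λ` (square-free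
product of Kolyvagin primes, `n' = 1` allowed) and a datum `d'` of conductor `n'` on the same frame with
`d'.kolyvaginClass _ 1 ≠ 0` (the Selmer membership `κ̄_{n'} ∈ H¹_{BK(n')}` is dropped — weaker). Size L
(Howard's Kolyvagin-system formalism: the stub modules `𝒮^{(k)}(n)`, Lemma 2.16); no `_holds` here.
[cite: Zanarella2019, §1.1 (arXiv:1908.09197 pp. 3–4: setting, Assumption 1.1/1.3, definition of primitive), Def. 2.17, Prop. 2.18 (proof, first sentence), Rem. 2.20, §3.1]
[cite: GrossLMS1991, §4 (4.1), (4.4)] [cite: WZhang2014, Notations (xii) (M(ℓ), Λ, c_M(n))]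
[file NumberTheory/EllipticCurves/HeegnerPointsKolyvaginPrimitivity] -/
def Zanarella2019_kolyvaginClass_one_ne_zero_of_not_divisible : Prop :=
  ∀ (W : WeierstrassCurve ℚ) [W.IsElliptic] [W.IsGloballyMinimal] (p : ℕ) [hp : Fact p.Prime],
    5 ≤ p → W.HasGoodReductionAtPrime p → ¬ (p : ℤ) ∣ W.frobeniusTrace p →
    W.HasSurjectiveModNGaloisRep p →
    ∀ (K : Type) [Field K] [NumberField K], IsImaginaryQuadratic K → NumberField.discr K < -4 →
      ¬ ((p : ℤ) ∣ NumberField.discr K) →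
      IsCoprime (NumberField.discr K) ((W.conductorNorm ℤ : ℕ) : ℤ) →
      ∀ [NeZero (W.conductorNorm ℤ)], SatisfiesHeegnerHypothesis (W.conductorNorm ℤ) K →
      ∀ (Dt : ModularParametrizationData W (W.conductorNorm ℤ)) (β : ℤ) (ι : K →+* ℂ)
        (n : ℕ) (d : KolyvaginHeegnerData Dt β ι n) (M : ℕ), n ≠ 1 →
        KolyvaginDescent.KolSupp (Zhang2014.IsKolyvaginPrime (W.conductorNorm ℤ) W K p) n →
        (M : ℕ∞) = Zhang2014.levelIndex W p n →
        (¬ ∃ ξ : (W.baseChange K).galH1Torsion ((p ^ M : ℕ) : ℤ),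
            (p : ℤ) • ξ = d.kolyvaginClass hp.out M) →
        ∃ (n' : ℕ) (d' : KolyvaginHeegnerData Dt β ι n'),
          KolyvaginDescent.KolSupp (Zhang2014.IsKolyvaginPrime (W.conductorNorm ℤ) W K p) n' ∧
            d'.kolyvaginClass hp.out 1 ≠ 0

end Literature.NumberTheory.EllipticCurves
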